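import Summits.HodgeConjecture.HodgeConjecture.Theorems.SixfoldTableXCensusWeilProductRowsGeneral
import Literature.AlgebraicGeometry.HodgeTheory.WeilTypeFivefoldTimesCMCurveHodgeLieSU
import Literature.AlgebraicGeometry.HodgeTheory.WeilTypeBlockedHodgeGroupOfLie
import Literature.AlgebraicGeometry.Motives.HodgeLieUnitarySUDerived
import Literature.AlgebraicGeometry.HodgeTheory.CMHodgeGroupCrossedClasses
import HarnessLib

/-!
# TABLE X (dimension 6) — ROW 17 `g6.ExY5.(3,2)` (`A ∼ Y₅ × E_k`: `Y` a simple non-CM fivefold with `End⁰ = k` of signature `(3,2)`,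
# `E` an elliptic curve with CM by the SAME `k`, the diagonal `k` of Weil type `(3,3)`), EVERY MEMBER: the census nodes X2 ∕ X1
# (+ domain, isogeny class) with L17's displayed general-member hypothesis `hG` DISCHARGED — «special members = ∅» for row 17 —
# and the HC readings ⟸ the DISPLAYED residue binders (cell `pub-hodgeav-hg6`, req-37 (A) Q2b; eng-4 g9, brick R17-C; lead g4 GO
# 2026-08-29T08:29:15Z)

HONEST FRAMING. HC, `HC_AV` (stmt-1333), `HC_CM` (stmt-3052) and H2 are NOT proved and do not occur. X2 ∕ X1 stay `@[conjecture]`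
(OURS); `WeilSixfolds` (stmt-HodgeConjecture-2524), R-W6 and Markman₆ (preprint, unrefereed) appear only as displayed hypotheses of §2.
KERNEL ONLY: theorems over existing declarations; no definition, no `sorry`, no named fact; restates nothing. NO Lie or Hodge-group
hypothesis is displayed (R17-AV's `hSL₁` is discharged here by eng-5's K1b `UnitarySU.mem_span_commutator_of_trace`, exactly as in the
tree's primed form `hodgeLieC_fivefold_prod_cmCurve_of_twoThree'`).

THE CHAIN (all in the tree): (i) the row-17 Lie theorem at the product `hodgeLieC_fivefold_prod_cmCurve_of_twoThree`
(`WeilTypeFivefoldTimesCMCurveHodgeLieSU`, R17-AV: eng-5's product brick `WeilProductCM.mem_hodgeLieC_of_commute_of_skew_of_trace` read on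
`Y × E`, `hLie₁` discharged by the `(3,2)` core, `hSL₁` by K1b) ⟹ (ii) eng-2's BLOCKED Lie → group socket
`IsWeilType.mem_hodgeGroupOne_of_mem_unitaryCentralizerGroup_blocked_of_hodgeLieC` (`WeilTypeBlockedHodgeGroupOfLie`, S3: any block pattern —
here `(5,1)`) ⟹ `hG` (§0 `hG_of_fivefold_prod_cmCurve`) ⟹ (iii) L17 `census_weilType_general_prod` at `(dim Y, dim C) = (5, 1)` (§1) and
L16's no-domain HC readings (§2). The conversion «commutes with Milne's generator `φ_E^*`» ⟹ «commutes with the projector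
`e₁^* = (fst ≫ prodLift (𝟙 Y) 0)^*`» is PROVED from the socket's own data: `End_Hdg(H¹(Y × E)) = ℚ[φ_E^*]`
(`exists_eq_sum_smul_pow_bettiMapHom_fin`: `finrank_ℚ End⁰ = 2|ι|` and `2|ι|` distinct eigenvalues with non-zero eigenspaces), so `e₁^*`
is a rational polynomial in `φ_E^*`, acting by a scalar on each eigenspace of `φ_E^*_ℂ` (`baseChange_sum_smul_pow_apply_fin`), and an
operator commuting with `φ_E^*_ℂ` preserves those eigenspaces (they span, `htop`); «commutes with `Φ^*`» is the socket's own first hypothesis.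

MEMBER DATA OF RECORD (row 17, every member, stated AT THE PRODUCT `Y × E`; every member `A ∼ Y × E` is covered by the `_of_isIsogenous`
forms): `Y` simple non-CM of dimension `5` with `finrank_ℚ End⁰(Y) = 2`, `φ_Y ≫ φ_Y = −d`, multiplicity `2` or `3` at `i√d`; `E` of
dimension `1` with `χ ≫ χ = −d`; the diagonal `Φ` (`Φ ≫ fst = fst ≫ φ_Y`, `Φ ≫ snd = snd ≫ χ`) of Weil type `(3, d)`; Milne's single-generator
data for `C(Y × E) ⊗ ℂ` (`φ_E`, `hC`, `hdiag`, `J'`, `hJ'`, `hJQ`) and the socket's block data on the SAME `φ_E` (`finrank_ℚ End⁰(Y × E) = 2|ι|`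
— i.e. `Hom(Y, E) = 0`, `End⁰ = k × k` —, colours `μ` with non-zero blocks spanning `H¹`, `W_{μ k} ⊆ W_k`, `W_{μ̄ k} ⊆ W̄_k`), a
rational class `h` with a Kähler multiple and `hφQ`. All declarations in L17's namespace `TableX.WeilERows`; typed ≠ proved.

## References
* [MoonenZarhin1999LowDim] B. Moonen, Yu. Zarhin, Math. Ann. 315 (1999), Thm. 0.2, §2 (2.4), (2.7), §5 (5.3), (5.11).
* [Milne1999LefschetzClasses] J. S. Milne, Duke Math. J. 96 (1999), §2 pp. 645–650, Thm. 3.2 and Cor. 4.5.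
* [vanGeemen1994HodgeAV] B. van Geemen, LNM 1594 (1994), Thm. 6.12 and 4.9.
* [Deligne1982HodgeCycles] P. Deligne, LNM 900 (1982), I §3 Prop. 3.4 and 3.6.
-/

set_option linter.dupNamespace false

noncomputable section

open scoped TensorProduct
open CategoryTheory CategoryTheory.Limits
open Literature.AlgebraicGeometry Literature.AlgebraicGeometry.Motives
open Literature.AlgebraicGeometry.Motives.AbelianVariety
open Literature.AlgebraicGeometry.Motives.HodgeStructure
open Literature.AlgebraicGeometry.HodgeTheory
open Literature.AlgebraicGeometry.Milne1999
open Literature.AlgebraicGeometry.ComplexMultiplication (bettiRep bettiRep_of)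
open Literature.AlgebraicGeometry.Deligne1982 (isOfHodgeType_one_one_of_isKaehlerClass_smul)
open Literature.AlgebraicGeometry.VanGeemen1994 (pullbackOne hodgeGroupOne detOnEigenspace hodgeClassSpan)
open Literature.AlgebraicTopology.SingularHomology
open Literature.Barriers.HodgeConjecture
open Literature.Geometry.Kaehler (HasHardLefschetzProperty)
open Summit.HodgeConjecture.HodgeConjecture.Ring2.ClassTargets
open Summit.HodgeConjecture.HodgeConjecture.Ring2.Motiv (ProdCMCell)
open Summit.HodgeConjecture.HodgeConjecture.Ring2.Atlas (IsQuarticFieldTypeIVFourfold)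

namespace Summit.HodgeConjecture.HodgeConjecture.TableX.WeilERows

variable {Y E : AbelianVariety ℂ} {h : complexBetti (Y.prod E).X 2}

/-- The two elements of `Fin 2`. [folklore] -/
private theorem fin2_cases (r : Fin 2) : r = 0 ∨ r = 1 := by
  fin_cases r <;> simp

/-! ## §0 The group hypothesis `hG` of L17 is a theorem at `Y₅ × E_k` -/

/-- **`hG` FOR ROW 17 AT THE PRODUCT `Y₅ × E_k`** (see the module docstring): R17-AV's Lie theorem ∘ eng-2's blocked socket; `h` a
rational class with a Kähler multiple for which `Φ^*` is a `d`-similitude. Nothing displayed beyond member data. HC NOT proved.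
[cite: MoonenZarhin1999LowDim, §2 (2.4) and §5 (5.3), (5.11)] [cite: Deligne1982HodgeCycles, I §3 Prop. 3.4 and 3.6] -/
theorem hG_of_fivefold_prod_cmCurve
    (hY5 : Y.dim = 5) (φY : Y ⟶ Y) {d : ℕ} (hd : 0 < d) (hφY : φY ≫ φY = -(d • 𝟙 Y))
    (hE2 : Module.finrank ℚ Y.endAlgebra = 2)
    (h23 : eigenMultiplicity Y φY (Complex.I * (Real.sqrt d : ℂ)) = 2 ∨ eigenMultiplicity Y φY (Complex.I * (Real.sqrt d : ℂ)) = 3)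
    (hE1 : E.dim = 1) (χ : E ⟶ E) (hχ : χ ≫ χ = -(d • 𝟙 E))
    (Φ : Y.prod E ⟶ Y.prod E) (hΦ₁ : Φ ≫ fst Y E = fst Y E ≫ φY) (hΦ₂ : Φ ≫ snd Y E = snd Y E ≫ χ)
    (hW : IsWeilType (Y.prod E) Φ 3 d)
    (φE : Y.prod E ⟶ Y.prod E) {ι : Type} [Fintype ι] [DecidableEq ι]
    (hEcard : Module.finrank ℚ (Y.prod E).endAlgebra = 2 * Fintype.card ι)
    (μ : ι → ℂ) (hinj : Function.Injective μ) (hdist : ∀ k k', μ k' ≠ starRingEnd ℂ (μ k))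
    (hWne : ∀ kt : ι × Fin 2, Module.End.eigenspace (((bettiCohomology.map φE.hom.hom.hom 1).hom).baseChange ℂ)
      (if kt.2 = 0 then μ kt.1 else starRingEnd ℂ (μ kt.1)) ≠ ⊥)
    (htop : (⨆ kt : ι × Fin 2, Module.End.eigenspace (((bettiCohomology.map φE.hom.hom.hom 1).hom).baseChange ℂ)
      (if kt.2 = 0 then μ kt.1 else starRingEnd ℂ (μ kt.1))) = ⊤)
    (hKE : ∀ k, Module.End.eigenspace (((bettiCohomology.map φE.hom.hom.hom 1).hom).baseChange ℂ) (μ k) ≤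
      Module.End.eigenspace (((bettiCohomology.map Φ.hom.hom.hom 1).hom).baseChange ℂ) (Complex.I * (Real.sqrt d : ℂ)))
    (hKE' : ∀ k, Module.End.eigenspace (((bettiCohomology.map φE.hom.hom.hom 1).hom).baseChange ℂ) (starRingEnd ℂ (μ k)) ≤
      Module.End.eigenspace (((bettiCohomology.map Φ.hom.hom.hom 1).hom).baseChange ℂ) (-(Complex.I * (Real.sqrt d : ℂ))))
    (hQ : IsRationalClass h) (hK : ∃ s : ℝ, 0 < s ∧ IsKaehlerClass (Y.prod E).dim (Y.prod E).X ((s : ℂ) • h))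
    (hφQ : ∀ x y, polarizationPairingOne (Y.prod E).X h ((Y.prod E).dim - 1) (pullbackOne (Y.prod E) Φ x) (pullbackOne (Y.prod E) Φ y) =
      (d : ℂ) • polarizationPairingOne (Y.prod E).X h ((Y.prod E).dim - 1) x y) :
    ∀ (u : complexBetti (Y.prod E).X 1 ≃ₗ[ℂ] complexBetti (Y.prod E).X 1) (hu : u ∈ unitaryCentralizerGroup (Y.prod E) h),
      detOnEigenspace u (pullbackOne (Y.prod E) Φ) (fun x ↦ (mem_centralizerGroup_iff.1 hu.1) Φ x)
        (Complex.I * (Real.sqrt d : ℂ)) = 1 → u ∈ hodgeGroupOne (Y.prod E).dim (Y.prod E).X := by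
  haveI : HodgeTensorFacts.{0, 0} := hodgeTensorFacts_holds
  obtain ⟨ψ⟩ := BettiUniverse.hodge_isPolarizable exists_isReal_hodgeModel_holds
    (AbelianVariety.isSmoothProjective_holds (A := Y.prod E)) 1
  have hX : IsSmoothProjective (Y.prod E).dim (Y.prod E).X := AbelianVariety.isSmoothProjective_holds
  -- `h` is a rational `(1,1)`-class; `Q_h` is non-degenerate on `H¹` (hard Lefschetz)
  obtain ⟨s, hs, hsK⟩ := hK
  have h11 : IsOfHodgeType (Y.prod E).dim (Y.prod E).X (2 * 1) 1 1 h := isOfHodgeType_one_one_of_isKaehlerClass_smul ⟨s, hs.ne', hsK⟩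
  have hh : h ∈ hodgeClassSpan (Y.prod E).dim (Y.prod E).X 1 := Submodule.subset_span ⟨hQ, h11⟩
  have hHL : HasHardLefschetzProperty h (Y.prod E).dim := by
    have h1 := HasHardLefschetzProperty.smul
      (hsK.hasHardLefschetzProperty hX fun _ ↦ Motives.hasHardLefschetzProperty_kaehlerClass_holds)
      (inv_ne_zero (Complex.ofReal_ne_zero.2 hs.ne'))
    rwa [smul_smul, inv_mul_cancel₀ (Complex.ofReal_ne_zero.2 hs.ne'), one_smul] at h1
  have hnd : ∀ x : complexBetti (Y.prod E).X 1, (∀ y, polarizationPairingOne (Y.prod E).X h ((Y.prod E).dim - 1) x y = 0) → x = 0 :=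
    fun x hx => eq_zero_of_forall_polarizationPairingOne_eq_zero_of_hasHardLefschetzProperty
      (by rw [hW.dim_eq]; norm_num) hHL hx
  -- `End_Hdg(H¹(Y × E)) = ℚ[φ_E^*]`: every pull-back, in particular the projector `e₁^*`, is a rational polynomial in `φ_E^*`
  have hHD : exists_isReal_hodgeModel := exists_isReal_hodgeModel_holds
  have hI : hodgePQ_independent_of_hodgeModel := hodgePQ_independent_of_hodgeModel_holds
  have hev : Function.Injective (fun kt : ι × Fin 2 => if kt.2 = 0 then μ kt.1 else starRingEnd ℂ (μ kt.1)) := by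
    rintro ⟨k, t⟩ ⟨k', t'⟩ h
    rcases fin2_cases t with rfl | rfl <;> rcases fin2_cases t' with rfl | rfl
    · simp only [if_true] at h; rw [hinj h]
    · simp only [if_true, one_ne_zero, if_false] at h; exact absurd h (hdist k' k)
    · simp only [one_ne_zero, if_false, if_true] at h; exact absurd h.symm (hdist k k')
    · simp only [one_ne_zero, if_false] at h; rw [hinj ((starRingEnd ℂ).injective h)]
  have hcard : Fintype.card (ι × Fin 2) = 2 * Fintype.card ι := by rw [Fintype.card_prod, Fintype.card_fin, mul_comm]
  set eqv : ι × Fin 2 ≃ Fin (2 * Fintype.card ι) := Fintype.equivFinOfCardEq hcard with heqv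
  have hEφ := exists_eq_sum_smul_pow_bettiMapHom_fin hHD hI φE hEcard (fun j => if (eqv.symm j).2 = 0 then μ (eqv.symm j).1
      else starRingEnd ℂ (μ (eqv.symm j).1)) (hev.comp eqv.symm.injective) (fun j => hWne (eqv.symm j))
  have heE : (bettiCohomology.map (fst Y E ≫ prodLift (𝟙 Y) (0 : Y ⟶ E)).hom.hom.hom 1).hom ∈
      (BettiUniverse.hodge hHD (AbelianVariety.isSmoothProjective_holds (A := Y.prod E)) 1).endAlg := by
    have h := unop_bettiRep_mem_endAlg hHD hI (AbelianVariety.endAlgebra.of (Y.prod E) (fst Y E ≫ prodLift (𝟙 Y) (0 : Y ⟶ E)))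
    rwa [bettiRep_of, MulOpposite.unop_op] at h
  obtain ⟨q, hq⟩ := hEφ _ heE
  -- the Lie statement in the socket's shape: «commutes with φ_E^*» gives «commutes with the projector»
  -- R17-AV's displayed `hSL₁` discharged by eng-5's K1b (`End_Hdg(H¹Y) = ℚ + ℚ φ_Y^*` from `finrank_ℚ End⁰(Y) = 2`)
  haveI : Module.Finite ℚ (bettiCohomology Y.X 1) := finite_bettiCohomology_one _
  have hφ₁E : (bettiCohomology.map φY.hom.hom.hom 1).hom ∈
      (BettiUniverse.hodge hHD (AbelianVariety.isSmoothProjective_holds (A := Y)) 1).endAlg := by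
    have h := unop_bettiRep_mem_endAlg hHD hI (AbelianVariety.endAlgebra.of Y φY)
    rwa [bettiRep_of, MulOpposite.unop_op] at h
  have hdQ : (0 : ℚ) < d := Nat.cast_pos.2 hd
  have hφ₁sq : (bettiCohomology.map φY.hom.hom.hom 1).hom * (bettiCohomology.map φY.hom.hom.hom 1).hom = -((d : ℚ) • 1) :=
    bettiMapHom_mul_self hφY
  have hsumY := eigenMultiplicity_add_eigenMultiplicity_neg_eq_dim Y φY hd hφY
  have hY0 : 0 < Y.dim := by omega
  have hEY := exists_eq_smul_one_add_smul_bettiMapHom hHD hI hd hφY hE2 hY0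
  have hLie := hodgeLieC_fivefold_prod_cmCurve_of_twoThree hY5 φY hd hφY hE2 h23 hE1 χ hχ Φ hΦ₁ hΦ₂ hW
    (fun ψ₁ T hTφ hTskew hTtr => UnitarySU.mem_span_commutator_of_trace
      (BettiUniverse.hodge hHD (AbelianVariety.isSmoothProjective_holds (A := Y)) 1) Nat.cast_one ψ₁ hφ₁E hdQ hφ₁sq hEY hTφ
      hTskew hTtr) ψ
  have hSU : ∀ (Yop : Module.End ℂ (ℂ ⊗[ℚ] bettiCohomology (Y.prod E).X 1))
      (hYφ : Yop * ((bettiCohomology.map Φ.hom.hom.hom 1).hom).baseChange ℂ =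
        ((bettiCohomology.map Φ.hom.hom.hom 1).hom).baseChange ℂ * Yop),
      Yop * ((bettiCohomology.map φE.hom.hom.hom 1).hom).baseChange ℂ =
        ((bettiCohomology.map φE.hom.hom.hom 1).hom).baseChange ℂ * Yop →
      (∀ x y, ψ.form.baseChange ℂ (Yop x) y + ψ.form.baseChange ℂ x (Yop y) = 0) →
      LinearMap.trace ℂ _ (Yop.restrict fun x (hx : x ∈ Module.End.eigenspace
          (((bettiCohomology.map Φ.hom.hom.hom 1).hom).baseChange ℂ) (Complex.I * (Real.sqrt d : ℂ))) =>
        UnitaryTheta.apply_mem_eigenspace_of_commute hYφ hx) = 0 →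
      Yop ∈ (BettiUniverse.hodge exists_isReal_hodgeModel_holds (AbelianVariety.isSmoothProjective_holds (A := Y.prod E)) 1).hodgeLieC := by
    intro Yop hYφ hYφE hYskew hYtr
    -- `Yop` commutes with `e₁^*_ℂ`: `e₁^* = Σ q_k (φ_E^*)^k` acts by a scalar on every eigenspace of `φ_E^*_ℂ`, which `Yop` preserves
    have hYe : Yop * ((bettiCohomology.map (fst Y E ≫ prodLift (𝟙 Y) (0 : Y ⟶ E)).hom.hom.hom 1).hom).baseChange ℂ =
        ((bettiCohomology.map (fst Y E ≫ prodLift (𝟙 Y) (0 : Y ⟶ E)).hom.hom.hom 1).hom).baseChange ℂ * Yop := by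
      have hB : ∀ {c : ℂ} {w : ℂ ⊗[ℚ] bettiCohomology (Y.prod E).X 1},
          w ∈ Module.End.eigenspace (((bettiCohomology.map φE.hom.hom.hom 1).hom).baseChange ℂ) c →
          ((bettiCohomology.map (fst Y E ≫ prodLift (𝟙 Y) (0 : Y ⟶ E)).hom.hom.hom 1).hom).baseChange ℂ w =
            (∑ k, (q k : ℂ) * c ^ (k : ℕ)) • w := by
        intro c w hw
        have h' := baseChange_sum_smul_pow_apply_fin _ q hw
        rwa [← hq] at h'
      refine LinearMap.ext fun v => ?_
      have hv : v ∈ ⨆ kt : ι × Fin 2, Module.End.eigenspace (((bettiCohomology.map φE.hom.hom.hom 1).hom).baseChange ℂ)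
          (if kt.2 = 0 then μ kt.1 else starRingEnd ℂ (μ kt.1)) := by rw [htop]; exact Submodule.mem_top
      refine Submodule.iSup_induction _
        (motive := fun v => (Yop * ((bettiCohomology.map (fst Y E ≫ prodLift (𝟙 Y) (0 : Y ⟶ E)).hom.hom.hom 1).hom).baseChange ℂ) v =
          (((bettiCohomology.map (fst Y E ≫ prodLift (𝟙 Y) (0 : Y ⟶ E)).hom.hom.hom 1).hom).baseChange ℂ * Yop) v) hv
        (fun kt w hw => ?_) (by simp only [map_zero]) (fun x y hx hy => by simp only [map_add, hx, hy])
      rw [Module.End.mul_apply, Module.End.mul_apply, hB hw, hB (UnitaryTheta.apply_mem_eigenspace_of_commute hYφE hw), map_smul]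
    exact hLie Yop hYe hYφ hYskew hYtr
  exact fun u hu hdet ↦ hW.mem_hodgeGroupOne_of_mem_unitaryCentralizerGroup_blocked_of_hodgeLieC φE hEcard μ hinj hdist hWne htop
    hKE hKE' ψ hSU hh hnd hφQ u hu hdet

/-! ## §1 Row 17, every member: the census at the product and on its isogeny class, `hG` discharged -/

/-- **TABLE X ROW 17 `g6.ExY5.(3,2)` — EVERY MEMBER, KERNEL VERDICT WITH DOMAIN MEMBERSHIP AT THE PRODUCT `Y₅ × E_k`, NO Hodge-group
hypothesis displayed**: L17's `census_weilType_general_prod` at `(dim Y, dim C) = (5, 1)` with `hG`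
DISCHARGED by §0. `Y` simple non-CM (`Y` not of CM type is a binder of L17's domain clause). Conclusion `(dim = 6 ∧ ¬ 𝒞) ∧` X2 `∧` X1 at
`Y × E`. «Special members = ∅» for row 17. HC NOT proved. [cite: MoonenZarhin1999LowDim, Thm. 0.2, §2 (2.4), §5 (5.3), (5.11)]
[cite: Milne1999LefschetzClasses, Thm. 3.2 and Cor. 4.5] [cite: vanGeemen1994HodgeAV, Thm. 6.12 and 4.9] -/
theorem census_row17_fivefold_prod_cmCurve (hYs : Y.IsSimple) (hYcm : ¬ IsOfCMType Y)
    (hY5 : Y.dim = 5) (φY : Y ⟶ Y) {d : ℕ} (hd : 0 < d) (hφY : φY ≫ φY = -(d • 𝟙 Y))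
    (hE2 : Module.finrank ℚ Y.endAlgebra = 2)
    (h23 : eigenMultiplicity Y φY (Complex.I * (Real.sqrt d : ℂ)) = 2 ∨ eigenMultiplicity Y φY (Complex.I * (Real.sqrt d : ℂ)) = 3)
    (hE1 : E.dim = 1) (χ : E ⟶ E) (hχ : χ ≫ χ = -(d • 𝟙 E))
    (Φ : Y.prod E ⟶ Y.prod E) (hΦ₁ : Φ ≫ fst Y E = fst Y E ≫ φY) (hΦ₂ : Φ ≫ snd Y E = snd Y E ≫ χ)
    (hW : IsWeilType (Y.prod E) Φ 3 d)
    (φE : Y.prod E ⟶ Y.prod E) {ι : Type} [Fintype ι] [DecidableEq ι]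
    (hEcard : Module.finrank ℚ (Y.prod E).endAlgebra = 2 * Fintype.card ι)
    (μ : ι → ℂ) (hinj : Function.Injective μ) (hdist : ∀ k k', μ k' ≠ starRingEnd ℂ (μ k))
    (hWne : ∀ kt : ι × Fin 2, Module.End.eigenspace (((bettiCohomology.map φE.hom.hom.hom 1).hom).baseChange ℂ)
      (if kt.2 = 0 then μ kt.1 else starRingEnd ℂ (μ kt.1)) ≠ ⊥)
    (htop : (⨆ kt : ι × Fin 2, Module.End.eigenspace (((bettiCohomology.map φE.hom.hom.hom 1).hom).baseChange ℂ)
      (if kt.2 = 0 then μ kt.1 else starRingEnd ℂ (μ kt.1))) = ⊤)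
    (hKE : ∀ k, Module.End.eigenspace (((bettiCohomology.map φE.hom.hom.hom 1).hom).baseChange ℂ) (μ k) ≤
      Module.End.eigenspace (((bettiCohomology.map Φ.hom.hom.hom 1).hom).baseChange ℂ) (Complex.I * (Real.sqrt d : ℂ)))
    (hKE' : ∀ k, Module.End.eigenspace (((bettiCohomology.map φE.hom.hom.hom 1).hom).baseChange ℂ) (starRingEnd ℂ (μ k)) ≤
      Module.End.eigenspace (((bettiCohomology.map Φ.hom.hom.hom 1).hom).baseChange ℂ) (-(Complex.I * (Real.sqrt d : ℂ))))
    (hC : centralizerAlgebra (Y.prod E) = Subalgebra.centralizer ℂ {pullbackOne (Y.prod E) φE})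
    (hdiag : ⨆ m : ℂ, Module.End.eigenspace (pullbackOne (Y.prod E) φE) m = ⊤)
    (hQ : IsRationalClass h) (hK : ∃ s : ℝ, 0 < s ∧ IsKaehlerClass (Y.prod E).dim (Y.prod E).X ((s : ℂ) • h))
    (J' : Module.End ℂ (complexBetti (Y.prod E).X 1))
    (hJ' : J' ∈ Subalgebra.centralizer ℂ (centralizerAlgebra (Y.prod E) : Set (Module.End ℂ (complexBetti (Y.prod E).X 1))))
    (hJQ : ∀ x y : complexBetti (Y.prod E).X 1,
      polarizationPairingOne (Y.prod E).X h ((Y.prod E).dim - 1) (pullbackOne (Y.prod E) φE x) y =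
        polarizationPairingOne (Y.prod E).X h ((Y.prod E).dim - 1) x (J' y))
    (hφQ : ∀ x y, polarizationPairingOne (Y.prod E).X h ((Y.prod E).dim - 1) (pullbackOne (Y.prod E) Φ x) (pullbackOne (Y.prod E) Φ y) =
      (d : ℂ) • polarizationPairingOne (Y.prod E).X h ((Y.prod E).dim - 1) x y) :
    ((Y.prod E).dim = 6 ∧ ¬ (IsOfCMType (Y.prod E) ∨ ProdCMCell IsQuarticFieldTypeIVFourfold (fun Z ↦ Z.dim = 2) (Y.prod E))) ∧
    (∀ c : complexBetti (Y.prod E).X (2 * 2), IsRationalClass c → IsOfHodgeType (Y.prod E).dim (Y.prod E).X (2 * 2) 2 2 c →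
      c ∈ divisorClassesSpan (Y.prod E).X (Y.prod E).dim 2 ⊔ Submodule.span ℂ {w' : complexBetti (Y.prod E).X (2 * 2) |
        ∃ (C : AbelianVariety ℂ) (g : (Y.prod E).X ⟶ C.X) (w : complexBetti C.X (2 * 2)), C.dim < (Y.prod E).dim ∧
          IsRationalClass w ∧ IsOfHodgeType C.dim C.X (2 * 2) 2 2 w ∧ w' = complexBetti.map g (2 * 2) w}) ∧
    (∀ c : complexBetti (Y.prod E).X (2 * 3), IsRationalClass c → IsOfHodgeType (Y.prod E).dim (Y.prod E).X (2 * 3) 3 3 c →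
      c ∈ divisorClassesSpan (Y.prod E).X (Y.prod E).dim 3 ⊔ Submodule.span ℂ {w' : complexBetti (Y.prod E).X (2 * 3) |
          ∃ (a : complexBetti (Y.prod E).X (2 * 2)) (b : complexBetti (Y.prod E).X (2 * 1)),
            IsRationalClass a ∧ IsOfHodgeType (Y.prod E).dim (Y.prod E).X (2 * 2) 2 2 a ∧ IsRationalClass b ∧
            IsOfHodgeType (Y.prod E).dim (Y.prod E).X (2 * 1) 1 1 b ∧ w' = cupProduct (two_mul_add_two_mul 2 1) a b} ⊔
        Submodule.span ℂ {w' : complexBetti (Y.prod E).X (2 * 3) |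
          ∃ (C : AbelianVariety ℂ) (g : (Y.prod E).X ⟶ C.X) (w : complexBetti C.X (2 * 3)), C.dim < (Y.prod E).dim ∧
            IsRationalClass w ∧ IsOfHodgeType C.dim C.X (2 * 3) 3 3 w ∧ w' = complexBetti.map g (2 * 3) w} ⊔
        Submodule.span ℂ {w' : complexBetti (Y.prod E).X (2 * 3) |
          ∃ (B' : AbelianVariety ℂ) (g : (Y.prod E).X ⟶ B'.X) (d : ℕ) (ψ : B' ⟶ B') (w : complexBetti B'.X (2 * 3)),
            B'.dim = 6 ∧ 0 < d ∧ ψ ≫ ψ = -(d • 𝟙 B') ∧ IsRationalClass w ∧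
            IsOfHodgeType B'.dim B'.X (2 * 3) 3 3 w ∧ w ∈ weilClassesOf B' ψ 3 d ∧
            w' = complexBetti.map g (2 * 3) w}) := by
  haveI : HodgeTensorFacts.{0, 0} := hodgeTensorFacts_holds
  have h0Y : 0 < Y.dim := by omega
  have hY : Y.dim ≠ 4 ∨ Module.finrank ℚ Y.endAlgebra ≠ 4 := Or.inl (by omega)
  have hCs : E.IsSimple := AbelianVariety.isSimple_of_dim_le_one hE1.le
  have h0C : 0 < E.dim := by omega
  have hC4 : E.dim < 4 := by omega
  exact census_weilType_general_prod (Y.prod E) Φ d hYs hYcm h0Y hY hCs h0C hC4 (IsIsogenous.refl _) hW φE hC hdiag hQ hK J' hJ' hJQ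
    hφQ (hG_of_fivefold_prod_cmCurve hY5 φY hd hφY hE2 h23 hE1 χ hχ Φ hΦ₁ hΦ₂ hW φE hEcard μ hinj hdist hWne htop hKE hKE' hQ hK hφQ)

/-- **Row 17, every member `A ∼ Y₅ × E_k`** (L17's `…_of_isIsogenous` with `hG` discharged): the census verdict on the whole isogeny class of
the product. HC NOT proved. [cite: MoonenZarhin1999LowDim, Thm. 0.2 and §5 (5.1), (5.11)] [cite: Milne1999LefschetzClasses, Thm. 3.2 and Cor. 4.5]
[cite: vanGeemen1994HodgeAV, Lemma 3.7 and Thm. 6.12] -/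
theorem census_row17_of_isIsogenous_fivefold_prod_cmCurve {A' : AbelianVariety ℂ} (hYs : Y.IsSimple) (hYcm : ¬ IsOfCMType Y)
    (hY5 : Y.dim = 5) (φY : Y ⟶ Y) {d : ℕ} (hd : 0 < d) (hφY : φY ≫ φY = -(d • 𝟙 Y))
    (hE2 : Module.finrank ℚ Y.endAlgebra = 2)
    (h23 : eigenMultiplicity Y φY (Complex.I * (Real.sqrt d : ℂ)) = 2 ∨ eigenMultiplicity Y φY (Complex.I * (Real.sqrt d : ℂ)) = 3)
    (hE1 : E.dim = 1) (χ : E ⟶ E) (hχ : χ ≫ χ = -(d • 𝟙 E))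
    (Φ : Y.prod E ⟶ Y.prod E) (hΦ₁ : Φ ≫ fst Y E = fst Y E ≫ φY) (hΦ₂ : Φ ≫ snd Y E = snd Y E ≫ χ)
    (hW : IsWeilType (Y.prod E) Φ 3 d)
    (φE : Y.prod E ⟶ Y.prod E) {ι : Type} [Fintype ι] [DecidableEq ι]
    (hEcard : Module.finrank ℚ (Y.prod E).endAlgebra = 2 * Fintype.card ι)
    (μ : ι → ℂ) (hinj : Function.Injective μ) (hdist : ∀ k k', μ k' ≠ starRingEnd ℂ (μ k))
    (hWne : ∀ kt : ι × Fin 2, Module.End.eigenspace (((bettiCohomology.map φE.hom.hom.hom 1).hom).baseChange ℂ)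
      (if kt.2 = 0 then μ kt.1 else starRingEnd ℂ (μ kt.1)) ≠ ⊥)
    (htop : (⨆ kt : ι × Fin 2, Module.End.eigenspace (((bettiCohomology.map φE.hom.hom.hom 1).hom).baseChange ℂ)
      (if kt.2 = 0 then μ kt.1 else starRingEnd ℂ (μ kt.1))) = ⊤)
    (hKE : ∀ k, Module.End.eigenspace (((bettiCohomology.map φE.hom.hom.hom 1).hom).baseChange ℂ) (μ k) ≤
      Module.End.eigenspace (((bettiCohomology.map Φ.hom.hom.hom 1).hom).baseChange ℂ) (Complex.I * (Real.sqrt d : ℂ)))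
    (hKE' : ∀ k, Module.End.eigenspace (((bettiCohomology.map φE.hom.hom.hom 1).hom).baseChange ℂ) (starRingEnd ℂ (μ k)) ≤
      Module.End.eigenspace (((bettiCohomology.map Φ.hom.hom.hom 1).hom).baseChange ℂ) (-(Complex.I * (Real.sqrt d : ℂ))))
    (hC : centralizerAlgebra (Y.prod E) = Subalgebra.centralizer ℂ {pullbackOne (Y.prod E) φE})
    (hdiag : ⨆ m : ℂ, Module.End.eigenspace (pullbackOne (Y.prod E) φE) m = ⊤)
    (hQ : IsRationalClass h) (hK : ∃ s : ℝ, 0 < s ∧ IsKaehlerClass (Y.prod E).dim (Y.prod E).X ((s : ℂ) • h))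
    (J' : Module.End ℂ (complexBetti (Y.prod E).X 1))
    (hJ' : J' ∈ Subalgebra.centralizer ℂ (centralizerAlgebra (Y.prod E) : Set (Module.End ℂ (complexBetti (Y.prod E).X 1))))
    (hJQ : ∀ x y : complexBetti (Y.prod E).X 1,
      polarizationPairingOne (Y.prod E).X h ((Y.prod E).dim - 1) (pullbackOne (Y.prod E) φE x) y =
        polarizationPairingOne (Y.prod E).X h ((Y.prod E).dim - 1) x (J' y))
    (hφQ : ∀ x y, polarizationPairingOne (Y.prod E).X h ((Y.prod E).dim - 1) (pullbackOne (Y.prod E) Φ x) (pullbackOne (Y.prod E) Φ y) =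
      (d : ℂ) • polarizationPairingOne (Y.prod E).X h ((Y.prod E).dim - 1) x y)
    (hA'A : IsIsogenous A' (Y.prod E)) :
    (A'.dim = 6 ∧ ¬ (IsOfCMType A' ∨ ProdCMCell IsQuarticFieldTypeIVFourfold (fun Z ↦ Z.dim = 2) A')) ∧
    (∀ c : complexBetti A'.X (2 * 2), IsRationalClass c → IsOfHodgeType A'.dim A'.X (2 * 2) 2 2 c →
      c ∈ divisorClassesSpan A'.X A'.dim 2 ⊔ Submodule.span ℂ {w' : complexBetti A'.X (2 * 2) |
        ∃ (C : AbelianVariety ℂ) (g : A'.X ⟶ C.X) (w : complexBetti C.X (2 * 2)), C.dim < A'.dim ∧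
          IsRationalClass w ∧ IsOfHodgeType C.dim C.X (2 * 2) 2 2 w ∧ w' = complexBetti.map g (2 * 2) w}) ∧
    (∀ c : complexBetti A'.X (2 * 3), IsRationalClass c → IsOfHodgeType A'.dim A'.X (2 * 3) 3 3 c →
      c ∈ divisorClassesSpan A'.X A'.dim 3 ⊔ Submodule.span ℂ {w' : complexBetti A'.X (2 * 3) |
          ∃ (a : complexBetti A'.X (2 * 2)) (b : complexBetti A'.X (2 * 1)),
            IsRationalClass a ∧ IsOfHodgeType A'.dim A'.X (2 * 2) 2 2 a ∧ IsRationalClass b ∧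
            IsOfHodgeType A'.dim A'.X (2 * 1) 1 1 b ∧ w' = cupProduct (two_mul_add_two_mul 2 1) a b} ⊔
        Submodule.span ℂ {w' : complexBetti A'.X (2 * 3) |
          ∃ (C : AbelianVariety ℂ) (g : A'.X ⟶ C.X) (w : complexBetti C.X (2 * 3)), C.dim < A'.dim ∧
            IsRationalClass w ∧ IsOfHodgeType C.dim C.X (2 * 3) 3 3 w ∧ w' = complexBetti.map g (2 * 3) w} ⊔
        Submodule.span ℂ {w' : complexBetti A'.X (2 * 3) |
          ∃ (B' : AbelianVariety ℂ) (g : A'.X ⟶ B'.X) (d : ℕ) (ψ : B' ⟶ B') (w : complexBetti B'.X (2 * 3)),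
            B'.dim = 6 ∧ 0 < d ∧ ψ ≫ ψ = -(d • 𝟙 B') ∧ IsRationalClass w ∧
            IsOfHodgeType B'.dim B'.X (2 * 3) 3 3 w ∧ w ∈ weilClassesOf B' ψ 3 d ∧
            w' = complexBetti.map g (2 * 3) w}) := by
  haveI : HodgeTensorFacts.{0, 0} := hodgeTensorFacts_holds
  have h0Y : 0 < Y.dim := by omega
  have hY : Y.dim ≠ 4 ∨ Module.finrank ℚ Y.endAlgebra ≠ 4 := Or.inl (by omega)
  have hCs : E.IsSimple := AbelianVariety.isSimple_of_dim_le_one hE1.le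
  have h0C : 0 < E.dim := by omega
  have hC4 : E.dim < 4 := by omega
  exact census_weilType_general_prod_of_isIsogenous (Y.prod E) Φ d hYs hYcm h0Y hY hCs h0C hC4 (IsIsogenous.refl _) hW φE hC hdiag hQ
    hK J' hJ' hJQ hφQ (hG_of_fivefold_prod_cmCurve hY5 φY hd hφY hE2 h23 hE1 χ hχ Φ hΦ₁ hΦ₂ hW φE hEcard μ hinj hdist hWne htop hKE hKE' hQ hK hφQ) hA'A

/-! ## §2 HC at every row-17 member ⟸ the DISPLAYED residue binders -/

/-- **HC for every `A ∼ Y₅ × E_k` of row 17 ⟸ the ladder item `WeilSixfolds` (stmt-HodgeConjecture-2524, DISPLAYED, not asserted)**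
— L16's no-domain `hodgeConjectureFor_weilType_generalE_of_weilSixfolds` at the product with `hG` discharged, transported along the
isogeny. HC NOT proved unconditionally. [cite: vanGeemen1994HodgeAV, 2.4, Lemma 3.7 and Thm. 6.12] [cite: Milne1999LefschetzClasses, Cor. 4.5]
[cite: MoonenZarhin1999LowDim, Thm. 0.2 and §5 (5.11)] -/
theorem hodgeConjectureFor_of_isIsogenous_row17_of_weilSixfolds {A' : AbelianVariety ℂ}
    (hW₆ : Theses.SevenfoldWeilCensus.WeilSixfolds)
    (hY5 : Y.dim = 5) (φY : Y ⟶ Y) {d : ℕ} (hd : 0 < d) (hφY : φY ≫ φY = -(d • 𝟙 Y))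
    (hE2 : Module.finrank ℚ Y.endAlgebra = 2)
    (h23 : eigenMultiplicity Y φY (Complex.I * (Real.sqrt d : ℂ)) = 2 ∨ eigenMultiplicity Y φY (Complex.I * (Real.sqrt d : ℂ)) = 3)
    (hE1 : E.dim = 1) (χ : E ⟶ E) (hχ : χ ≫ χ = -(d • 𝟙 E))
    (Φ : Y.prod E ⟶ Y.prod E) (hΦ₁ : Φ ≫ fst Y E = fst Y E ≫ φY) (hΦ₂ : Φ ≫ snd Y E = snd Y E ≫ χ)
    (hW : IsWeilType (Y.prod E) Φ 3 d)
    (φE : Y.prod E ⟶ Y.prod E) {ι : Type} [Fintype ι] [DecidableEq ι]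
    (hEcard : Module.finrank ℚ (Y.prod E).endAlgebra = 2 * Fintype.card ι)
    (μ : ι → ℂ) (hinj : Function.Injective μ) (hdist : ∀ k k', μ k' ≠ starRingEnd ℂ (μ k))
    (hWne : ∀ kt : ι × Fin 2, Module.End.eigenspace (((bettiCohomology.map φE.hom.hom.hom 1).hom).baseChange ℂ)
      (if kt.2 = 0 then μ kt.1 else starRingEnd ℂ (μ kt.1)) ≠ ⊥)
    (htop : (⨆ kt : ι × Fin 2, Module.End.eigenspace (((bettiCohomology.map φE.hom.hom.hom 1).hom).baseChange ℂ)
      (if kt.2 = 0 then μ kt.1 else starRingEnd ℂ (μ kt.1))) = ⊤)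
    (hKE : ∀ k, Module.End.eigenspace (((bettiCohomology.map φE.hom.hom.hom 1).hom).baseChange ℂ) (μ k) ≤
      Module.End.eigenspace (((bettiCohomology.map Φ.hom.hom.hom 1).hom).baseChange ℂ) (Complex.I * (Real.sqrt d : ℂ)))
    (hKE' : ∀ k, Module.End.eigenspace (((bettiCohomology.map φE.hom.hom.hom 1).hom).baseChange ℂ) (starRingEnd ℂ (μ k)) ≤
      Module.End.eigenspace (((bettiCohomology.map Φ.hom.hom.hom 1).hom).baseChange ℂ) (-(Complex.I * (Real.sqrt d : ℂ))))
    (hC : centralizerAlgebra (Y.prod E) = Subalgebra.centralizer ℂ {pullbackOne (Y.prod E) φE})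
    (hdiag : ⨆ m : ℂ, Module.End.eigenspace (pullbackOne (Y.prod E) φE) m = ⊤)
    (hQ : IsRationalClass h) (hK : ∃ s : ℝ, 0 < s ∧ IsKaehlerClass (Y.prod E).dim (Y.prod E).X ((s : ℂ) • h))
    (J' : Module.End ℂ (complexBetti (Y.prod E).X 1))
    (hJ' : J' ∈ Subalgebra.centralizer ℂ (centralizerAlgebra (Y.prod E) : Set (Module.End ℂ (complexBetti (Y.prod E).X 1))))
    (hJQ : ∀ x y : complexBetti (Y.prod E).X 1,
      polarizationPairingOne (Y.prod E).X h ((Y.prod E).dim - 1) (pullbackOne (Y.prod E) φE x) y =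
        polarizationPairingOne (Y.prod E).X h ((Y.prod E).dim - 1) x (J' y))
    (hφQ : ∀ x y, polarizationPairingOne (Y.prod E).X h ((Y.prod E).dim - 1) (pullbackOne (Y.prod E) Φ x) (pullbackOne (Y.prod E) Φ y) =
      (d : ℂ) • polarizationPairingOne (Y.prod E).X h ((Y.prod E).dim - 1) x y)
    (hA'A : IsIsogenous A' (Y.prod E)) : HodgeConjectureFor A'.dim A'.X := by
  haveI : HodgeTensorFacts.{0, 0} := hodgeTensorFacts_holds
  exact HodgeConjectureFor.of_isIsogenous hA'A
    (hodgeConjectureFor_weilType_generalE_of_weilSixfolds (Y.prod E) Φ d hW₆ hW φE hC hdiag hQ hK J' hJ' hJQ hφQ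
      (hG_of_fivefold_prod_cmCurve hY5 φY hd hφY hE2 h23 hE1 χ hχ Φ hΦ₁ hΦ₂ hW φE hEcard μ hinj hdist hWne htop hKE hKE' hQ hK hφQ))

/-- **HC for every `A ∼ Y₅ × E_k` of row 17 ⟸ {Markman₆ (preprint, UNREFEREED), R-W6 (OPEN)}, both DISPLAYED.** HC NOT proved
unconditionally. [cite: Markman2025SecantWeil, Thm. 1.5.1 (preprint, unrefereed)] [claim: Markman2025SurveySecant, status: under-review]
[cite: vanGeemen1994HodgeAV, Lemma 3.7 and Thm. 6.12] -/
theorem hodgeConjectureFor_of_isIsogenous_row17_of_markman₆_nonsplit {A' : AbelianVariety ℂ}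
    (hMark₆ : Markman2025_weilClasses_algebraic_hyperbolicSixfold) (hRW6 : WeilTypeLadder.NonsplitSixfolds)
    (hY5 : Y.dim = 5) (φY : Y ⟶ Y) {d : ℕ} (hd : 0 < d) (hφY : φY ≫ φY = -(d • 𝟙 Y))
    (hE2 : Module.finrank ℚ Y.endAlgebra = 2)
    (h23 : eigenMultiplicity Y φY (Complex.I * (Real.sqrt d : ℂ)) = 2 ∨ eigenMultiplicity Y φY (Complex.I * (Real.sqrt d : ℂ)) = 3)
    (hE1 : E.dim = 1) (χ : E ⟶ E) (hχ : χ ≫ χ = -(d • 𝟙 E))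
    (Φ : Y.prod E ⟶ Y.prod E) (hΦ₁ : Φ ≫ fst Y E = fst Y E ≫ φY) (hΦ₂ : Φ ≫ snd Y E = snd Y E ≫ χ)
    (hW : IsWeilType (Y.prod E) Φ 3 d)
    (φE : Y.prod E ⟶ Y.prod E) {ι : Type} [Fintype ι] [DecidableEq ι]
    (hEcard : Module.finrank ℚ (Y.prod E).endAlgebra = 2 * Fintype.card ι)
    (μ : ι → ℂ) (hinj : Function.Injective μ) (hdist : ∀ k k', μ k' ≠ starRingEnd ℂ (μ k))
    (hWne : ∀ kt : ι × Fin 2, Module.End.eigenspace (((bettiCohomology.map φE.hom.hom.hom 1).hom).baseChange ℂ)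
      (if kt.2 = 0 then μ kt.1 else starRingEnd ℂ (μ kt.1)) ≠ ⊥)
    (htop : (⨆ kt : ι × Fin 2, Module.End.eigenspace (((bettiCohomology.map φE.hom.hom.hom 1).hom).baseChange ℂ)
      (if kt.2 = 0 then μ kt.1 else starRingEnd ℂ (μ kt.1))) = ⊤)
    (hKE : ∀ k, Module.End.eigenspace (((bettiCohomology.map φE.hom.hom.hom 1).hom).baseChange ℂ) (μ k) ≤
      Module.End.eigenspace (((bettiCohomology.map Φ.hom.hom.hom 1).hom).baseChange ℂ) (Complex.I * (Real.sqrt d : ℂ)))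
    (hKE' : ∀ k, Module.End.eigenspace (((bettiCohomology.map φE.hom.hom.hom 1).hom).baseChange ℂ) (starRingEnd ℂ (μ k)) ≤
      Module.End.eigenspace (((bettiCohomology.map Φ.hom.hom.hom 1).hom).baseChange ℂ) (-(Complex.I * (Real.sqrt d : ℂ))))
    (hC : centralizerAlgebra (Y.prod E) = Subalgebra.centralizer ℂ {pullbackOne (Y.prod E) φE})
    (hdiag : ⨆ m : ℂ, Module.End.eigenspace (pullbackOne (Y.prod E) φE) m = ⊤)
    (hQ : IsRationalClass h) (hK : ∃ s : ℝ, 0 < s ∧ IsKaehlerClass (Y.prod E).dim (Y.prod E).X ((s : ℂ) • h))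
    (J' : Module.End ℂ (complexBetti (Y.prod E).X 1))
    (hJ' : J' ∈ Subalgebra.centralizer ℂ (centralizerAlgebra (Y.prod E) : Set (Module.End ℂ (complexBetti (Y.prod E).X 1))))
    (hJQ : ∀ x y : complexBetti (Y.prod E).X 1,
      polarizationPairingOne (Y.prod E).X h ((Y.prod E).dim - 1) (pullbackOne (Y.prod E) φE x) y =
        polarizationPairingOne (Y.prod E).X h ((Y.prod E).dim - 1) x (J' y))
    (hφQ : ∀ x y, polarizationPairingOne (Y.prod E).X h ((Y.prod E).dim - 1) (pullbackOne (Y.prod E) Φ x) (pullbackOne (Y.prod E) Φ y) =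
      (d : ℂ) • polarizationPairingOne (Y.prod E).X h ((Y.prod E).dim - 1) x y)
    (hA'A : IsIsogenous A' (Y.prod E)) : HodgeConjectureFor A'.dim A'.X := by
  haveI : HodgeTensorFacts.{0, 0} := hodgeTensorFacts_holds
  exact HodgeConjectureFor.of_isIsogenous hA'A
    (hodgeConjectureFor_weilType_generalE_of_markman₆_nonsplit (Y.prod E) Φ d hMark₆ hRW6 hW φE hC hdiag hQ hK J' hJ' hJQ hφQ
      (hG_of_fivefold_prod_cmCurve hY5 φY hd hφY hE2 h23 hE1 χ hχ Φ hΦ₁ hΦ₂ hW φE hEcard μ hinj hdist hWne htop hKE hKE' hQ hK hφQ))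

end Summit.HodgeConjecture.HodgeConjecture.TableX.WeilERows

end
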